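/- LEAD seat `ym-line-cbag-p1` (prover-ym-line-cbag-p1-g24-0), route `EguchiKawaiDirectionLadder` (ideator ym-idea-2, LINE 8),
crux K_A `TripleSmallBallMargin` (stmt-QuantumFields-27724), S10-D ingredient (LEAD): the PER-BLOCK PRICING step of the crux
assembly — the Vandermonde weight of a block times the block-local fibre bound `min{ρ², ψ}` is at most
`a·√b · (s)^{C(n,2)} · (s′)^{C(n,2)/2}` once `ρ ≤ a·∏_{j<k} pairFactor s x_{jk}` (rank-robust rigidity, E_rob) and `ψ ≤ b·s′^{C(n,2)}`
(rank-robust pair bound, Ψ_rob): the within-block exponent `3/2` per unordered pair of ARCH-27724 §3(iv) (`x·pairFactor s x ≤ s`,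
`min{A,B} ≤ √(AB)`).  Pure real/`ℝ≥0∞` bookkeeping, route-independent.  Nothing here bears on the Yang–Mills mass gap. -/
import Summits.QuantumFields.YangMills.Theorems.EguchiKawaiDirectionLadderFreeTripleOfRigidity
import HarnessLib

/-!
# Route `EguchiKawaiDirectionLadder`, crux `TripleSmallBallMargin`: per-block pricing (S10-D ingredient)

* `prod_Ioi_mul_pairFactor_le` — `(∏_{j<k} x_{jk}) · ∏_{j<k} pairFactor s x_{jk} ≤ s^{C(n,2)}` for `x ≥ 0`, `s ≥ 0`;
* `blockPricing_le` — for `ρ ψ : ℝ≥0∞` with `ρ ≤ ofReal(a · ∏ pairFactor s x)` and `ψ ≤ ofReal(b · s′^{C(n,2)})` (`a, b, s, s′ ≥ 0`, `x ≥ 0`):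
  `ofReal(∏_{j<k} x_{jk}) · min (ρ·ρ) ψ ≤ ofReal(a · √b · s^{C(n,2)} · √(s′^{C(n,2)}))`.
-/

set_option autoImplicit false

noncomputable section

open scoped ENNReal
open Literature.Barriers.QuantumFields

namespace Summit.QuantumFields.YangMills.Theorems.EguchiKawaiDirectionLadder

variable {n : ℕ}

/-- **Vandermonde cancellation on a block**: `(∏_{j<k} x_{jk}) · ∏_{j<k} pairFactor s x_{jk} ≤ s^{C(n,2)}`. -/
theorem prod_Ioi_mul_pairFactor_le (x : Fin n → Fin n → ℝ) (hx : ∀ j k, 0 ≤ x j k) {s : ℝ} (hs : 0 ≤ s) :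
    (∏ j : Fin n, ∏ k ∈ Finset.Ioi j, x j k) * ∏ j : Fin n, ∏ k ∈ Finset.Ioi j, pairFactor s (x j k) ≤ s ^ n.choose 2 := by
  rw [← Finset.prod_mul_distrib]
  simp_rw [← Finset.prod_mul_distrib]
  calc ∏ j : Fin n, ∏ k ∈ Finset.Ioi j, x j k * pairFactor s (x j k)
      ≤ ∏ j : Fin n, ∏ k ∈ Finset.Ioi j, s := by
        refine Finset.prod_le_prod (fun j _ => Finset.prod_nonneg fun k _ => mul_nonneg (hx j k) (pairFactor_nonneg hs _))
          fun j _ => Finset.prod_le_prod (fun k _ => mul_nonneg (hx j k) (pairFactor_nonneg hs _)) fun k _ => ?_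
        exact mul_pairFactor_le hs _
    _ = s ^ n.choose 2 := by
        simp_rw [Finset.prod_const, Finset.prod_pow_eq_pow_sum, sum_card_Ioi_eq_choose_two]

/-- **Per-block pricing.**  See the module docstring. -/
theorem blockPricing_le (x : Fin n → Fin n → ℝ) (hx : ∀ j k, 0 ≤ x j k) {a b s s' : ℝ} (ha : 0 ≤ a) (hb : 0 ≤ b)
    (hs : 0 ≤ s) (hs' : 0 ≤ s') {ρ ψ : ℝ≥0∞}
    (hρ : ρ ≤ ENNReal.ofReal (a * ∏ j : Fin n, ∏ k ∈ Finset.Ioi j, pairFactor s (x j k)))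
    (hψ : ψ ≤ ENNReal.ofReal (b * s' ^ n.choose 2)) :
    ENNReal.ofReal (∏ j : Fin n, ∏ k ∈ Finset.Ioi j, x j k) * min (ρ * ρ) ψ ≤
      ENNReal.ofReal (a * Real.sqrt b * s ^ n.choose 2 * Real.sqrt (s' ^ n.choose 2)) := by
  set P : ℝ := ∏ j : Fin n, ∏ k ∈ Finset.Ioi j, pairFactor s (x j k) with hP
  set V : ℝ := ∏ j : Fin n, ∏ k ∈ Finset.Ioi j, x j k with hV
  have hP0 : 0 ≤ P := Finset.prod_nonneg fun _ _ => Finset.prod_nonneg fun _ _ => pairFactor_nonneg hs _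
  have hV0 : 0 ≤ V := Finset.prod_nonneg fun _ _ => Finset.prod_nonneg fun _ _ => hx _ _
  have haP : 0 ≤ a * P := mul_nonneg ha hP0
  have hbs : 0 ≤ b * s' ^ n.choose 2 := mul_nonneg hb (pow_nonneg hs' _)
  -- `min(ρ², ψ) ≤ ofReal(min((aP)², b s'^P)) ≤ ofReal(aP · √(b s'^P))`
  have hmin : min (ρ * ρ) ψ ≤ ENNReal.ofReal (a * P * Real.sqrt (b * s' ^ n.choose 2)) := by
    have h1 : ρ * ρ ≤ ENNReal.ofReal ((a * P) ^ 2) := by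
      rw [sq, ENNReal.ofReal_mul haP]; exact mul_le_mul hρ hρ bot_le bot_le
    refine (min_le_min h1 hψ).trans ?_
    rw [← ENNReal.ofReal_min]
    exact ENNReal.ofReal_le_ofReal (min_sq_le_mul_sqrt haP hbs)
  calc ENNReal.ofReal V * min (ρ * ρ) ψ ≤ ENNReal.ofReal V * ENNReal.ofReal (a * P * Real.sqrt (b * s' ^ n.choose 2)) := by
        gcongr
    _ = ENNReal.ofReal (a * Real.sqrt b * (V * P) * Real.sqrt (s' ^ n.choose 2)) := by
        rw [← ENNReal.ofReal_mul hV0, Real.sqrt_mul hb]; ring_nf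
    _ ≤ ENNReal.ofReal (a * Real.sqrt b * s ^ n.choose 2 * Real.sqrt (s' ^ n.choose 2)) := by
        refine ENNReal.ofReal_le_ofReal ?_
        have hVP : V * P ≤ s ^ n.choose 2 := prod_Ioi_mul_pairFactor_le x hx hs
        have h0 : 0 ≤ a * Real.sqrt b := mul_nonneg ha (Real.sqrt_nonneg _)
        have h1 : 0 ≤ Real.sqrt (s' ^ n.choose 2) := Real.sqrt_nonneg _
        calc a * Real.sqrt b * (V * P) * Real.sqrt (s' ^ n.choose 2)
            = (a * Real.sqrt b * Real.sqrt (s' ^ n.choose 2)) * (V * P) := by ring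
          _ ≤ (a * Real.sqrt b * Real.sqrt (s' ^ n.choose 2)) * s ^ n.choose 2 :=
              mul_le_mul_of_nonneg_left hVP (mul_nonneg h0 h1)
          _ = a * Real.sqrt b * s ^ n.choose 2 * Real.sqrt (s' ^ n.choose 2) := by ring

end Summit.QuantumFields.YangMills.Theorems.EguchiKawaiDirectionLadder

end
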